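import Summits.AtomisticToContinuum.Crystallization.Theses.PalmUnimodularRigidity
import Summits.AtomisticToContinuum.Crystallization.Theorems.MinimiserShells.Negative.LoadBearing
import Summits.AtomisticToContinuum.Crystallization.Theorems.MinimiserShells.Negative.Rootedness
import Literature.Probability.Process.PointStationaryLaw
import Literature.MathematicalPhysics.StatisticalMechanics.RootEnergy
import Literature.MathematicalPhysics.StatisticalMechanics.MuGSC
import Summits.AtomisticToContinuum.Crystallization.Theorems.PalmUnimodularRigidityMinimiserShellsEnergyFloorDefs

/-!
# Energy floor `e_uni ≥ e*` (route item 9229 `UnimodularEnergyLowerBound`), part C: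
# Lennard-Jones sums over rooted separated sets; the measurable root energy — lemmas

Support file for stub `stub_energyFloor` (S2) of line `equilibrium-in-law-surgery` of crux
`MinimiserShells` (stmt-AtomisticToContinuum-9225), which discharges route item
stmt-AtomisticToContinuum-9229 `UnimodularEnergyLowerBound` ("e_uni ≥ e*": every point-stationary
hard-core probability law on rooted configurations of `ℝ³` has mean root energy `E_P[h] ≥ e*`).

* Sums over a `δ`-separated set `S ∋ 0` of `ℝ³`, as `lintegral`s against `count|S`:
  `∑ ‖z‖⁻⁶ ≤ 250 δ⁻⁶` (`lintegral_inv_norm_pow_six_le`), `∑ V_LJ(‖z‖)⁻ ≤ 250/6 · δ⁻⁶`,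
  `∑ V_LJ(‖z‖)⁺ ≤ 250/12 · δ⁻¹²` (from the shell bound `sum_inv_pow_six_le_of_le_dist` and
  `V_LJ ≥ -r⁻⁶/6`, `V_LJ(r) ≤ δ⁻⁶ r⁻⁶/12` for `r ≥ δ`); the generic bound
  `lintegral_count_restrict_le_of_sum_le` and `lintegral_count_restrict_eq_tsum`.
* `rootEnergy'` (of `…EnergyFloorDefs`) is Giry-measurable (`measurable_rootEnergy'`), equals the
  Bochner root energy `½ ∫ V_LJ(‖y‖) dμ` on rooted hard-core configurations
  (`rootEnergy'_eq_of_hc`) and is bounded there (`rootEnergy'_bounds_of_hc`).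
-/

noncomputable section

open MeasureTheory Filter
open scoped ENNReal BigOperators Topology

namespace Summit.AtomisticToContinuum.Crystallization.Theorems.PalmUnimodularRigidityMinimiserShells.EnergyFloor

open Literature.Probability.Process (IsRootedHardCore)
open Literature.MathematicalPhysics.StatisticalMechanics (lennardJones lennardJones_zero
  sum_inv_pow_six_le_of_le_dist)
open Summit.AtomisticToContinuum.Crystallization.Theorems.MinimiserShells.Negative.Rootedness
  (countable_of_separated)

/-! ## Lennard-Jones sums over rooted separated sets -/

section Sums

variable {δ : ℝ} {S : Set (EuclideanSpace ℝ (Fin 3))}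

/-- `∫⁻ f d(count|S)` is bounded by any uniform bound on the finite partial sums over `S`. -/
theorem lintegral_count_restrict_le_of_sum_le (hS : S.Countable)
    {f : EuclideanSpace ℝ (Fin 3) → ℝ≥0∞} {c : ℝ≥0∞}
    (h : ∀ T : Finset (EuclideanSpace ℝ (Fin 3)), (↑T : Set (EuclideanSpace ℝ (Fin 3))) ⊆ S →
      ∑ z ∈ T, f z ≤ c) :
    ∫⁻ z, f z ∂((Measure.count : Measure (EuclideanSpace ℝ (Fin 3))).restrict S) ≤ c := by
  rw [lintegral_countable _ hS]
  simp only [Measure.count_singleton, mul_one]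
  rw [ENNReal.tsum_eq_iSup_sum]
  refine iSup_le fun T' => ?_
  have hsub : (↑(T'.map (Function.Embedding.subtype (· ∈ S))) : Set (EuclideanSpace ℝ (Fin 3))) ⊆ S := by
    intro z hz
    obtain ⟨w, -, rfl⟩ := Finset.mem_map.1 (Finset.mem_coe.1 hz)
    exact w.2
  calc ∑ z ∈ T', f (z : EuclideanSpace ℝ (Fin 3))
      = ∑ z ∈ T'.map (Function.Embedding.subtype (· ∈ S)), f z := by rw [Finset.sum_map]; rfl
    _ ≤ c := h _ hsub

/-- `∫⁻ f d(count|S) = ∑' z : S, f z`. -/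
theorem lintegral_count_restrict_eq_tsum (hS : S.Countable) (f : EuclideanSpace ℝ (Fin 3) → ℝ≥0∞) :
    ∫⁻ z, f z ∂((Measure.count : Measure (EuclideanSpace ℝ (Fin 3))).restrict S) = ∑' z : S, f z := by
  rw [lintegral_countable _ hS]
  simp only [Measure.count_singleton, mul_one]

/-- **Shell sum from the root**: for a finite subset `T` of a `δ`-separated set `S ∋ 0`,
`∑_{z ∈ T} ‖z‖⁻⁶ ≤ 250 δ⁻⁶` (the root term is `0⁻⁶ = 0` in Lean). -/
theorem sum_inv_norm_pow_six_le (hδ : 0 < δ) (h0 : (0 : EuclideanSpace ℝ (Fin 3)) ∈ S)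
    (hsep : ∀ x ∈ S, ∀ y ∈ S, x ≠ y → δ ≤ dist x y) (T : Finset (EuclideanSpace ℝ (Fin 3)))
    (hT : (↑T : Set (EuclideanSpace ℝ (Fin 3))) ⊆ S) :
    ∑ z ∈ T, ‖z‖⁻¹ ^ 6 ≤ 250 * δ⁻¹ ^ 6 := by
  classical
  rw [← Finset.sum_filter_add_sum_filter_not T (fun z => z ≠ 0)]
  have hzero : ∑ z ∈ T.filter (fun z => ¬ z ≠ 0), ‖z‖⁻¹ ^ 6 = 0 := by
    refine Finset.sum_eq_zero fun z hz => ?_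
    have : z = 0 := by simpa using (Finset.mem_filter.1 hz).2
    simp [this]
  rw [hzero, add_zero]
  have h := sum_inv_pow_six_le_of_le_dist (T.filter fun z => z ≠ 0) 0 hδ
    (fun z hz => by
      have hz' := Finset.mem_filter.1 hz
      rw [dist_comm]
      exact hsep z (hT hz'.1) 0 h0 hz'.2)
    (fun z hz w hw hzw => hsep z (hT (Finset.mem_filter.1 hz).1) w (hT (Finset.mem_filter.1 hw).1) hzw)
  simpa [dist_zero_left] using h

/-- `V_LJ(r)⁻ ≤ r⁻⁶/6`. -/
theorem neg_lennardJones_le (r : ℝ) : -lennardJones r ≤ (1 / 6) * r⁻¹ ^ 6 := by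
  have : 0 ≤ (1 / 12) * (r⁻¹) ^ 12 := by positivity
  unfold lennardJones
  linarith

/-- `V_LJ(r) ≤ δ⁻⁶ r⁻⁶ / 12` for `r ≥ δ > 0`. -/
theorem lennardJones_le_of_le (hδ : 0 < δ) {r : ℝ} (hr : δ ≤ r) :
    lennardJones r ≤ (1 / 12) * δ⁻¹ ^ 6 * r⁻¹ ^ 6 := by
  have hr0 : 0 < r := hδ.trans_le hr
  have h1 : r⁻¹ ^ 6 ≤ δ⁻¹ ^ 6 :=
    pow_le_pow_left₀ (inv_nonneg.2 hr0.le) ((inv_le_inv₀ hr0 hδ).2 hr) 6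
  have h2 : 0 ≤ r⁻¹ ^ 6 := by positivity
  have h3 : (r⁻¹) ^ 12 = (r⁻¹) ^ 6 * (r⁻¹) ^ 6 := by ring
  have h4 : 0 ≤ (1 / 6) * r⁻¹ ^ 6 := by positivity
  unfold lennardJones
  rw [h3]
  nlinarith [mul_le_mul_of_nonneg_right h1 h2]

/-- **`∑_{z ∈ S} ‖z‖⁻⁶ ≤ 250 δ⁻⁶`** for a `δ`-separated `S ∋ 0`, as a `lintegral` against `count|S`. -/
theorem lintegral_inv_norm_pow_six_le (hδ : 0 < δ) (h0 : (0 : EuclideanSpace ℝ (Fin 3)) ∈ S)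
    (hsep : ∀ x ∈ S, ∀ y ∈ S, x ≠ y → δ ≤ dist x y) :
    ∫⁻ z, ENNReal.ofReal (‖z‖⁻¹ ^ 6) ∂((Measure.count : Measure (EuclideanSpace ℝ (Fin 3))).restrict S)
      ≤ ENNReal.ofReal (250 * δ⁻¹ ^ 6) := by
  refine lintegral_count_restrict_le_of_sum_le (countable_of_separated hδ hsep) fun T hT => ?_
  rw [← ENNReal.ofReal_sum_of_nonneg fun z _ => by positivity]
  exact ENNReal.ofReal_le_ofReal (sum_inv_norm_pow_six_le hδ h0 hsep T hT)

/-- **Negative-part Lennard-Jones sum from the root**: `∑_{z ∈ S} V_LJ(‖z‖)⁻ ≤ 250/6 · δ⁻⁶`. -/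
theorem lintegral_ofReal_neg_lennardJones_le (hδ : 0 < δ) (h0 : (0 : EuclideanSpace ℝ (Fin 3)) ∈ S)
    (hsep : ∀ x ∈ S, ∀ y ∈ S, x ≠ y → δ ≤ dist x y) :
    ∫⁻ z, ENNReal.ofReal (-lennardJones ‖z‖)
      ∂((Measure.count : Measure (EuclideanSpace ℝ (Fin 3))).restrict S)
      ≤ ENNReal.ofReal (250 / 6 * δ⁻¹ ^ 6) := by
  refine lintegral_count_restrict_le_of_sum_le (countable_of_separated hδ hsep) fun T hT => ?_
  calc ∑ z ∈ T, ENNReal.ofReal (-lennardJones ‖z‖)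
      ≤ ∑ z ∈ T, ENNReal.ofReal ((1 / 6) * ‖z‖⁻¹ ^ 6) :=
        Finset.sum_le_sum fun z _ => ENNReal.ofReal_le_ofReal (neg_lennardJones_le _)
    _ = ENNReal.ofReal (∑ z ∈ T, (1 / 6) * ‖z‖⁻¹ ^ 6) :=
        (ENNReal.ofReal_sum_of_nonneg fun z _ => by positivity).symm
    _ ≤ ENNReal.ofReal (250 / 6 * δ⁻¹ ^ 6) := by
        apply ENNReal.ofReal_le_ofReal
        rw [← Finset.mul_sum]
        nlinarith [sum_inv_norm_pow_six_le hδ h0 hsep T hT]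

/-- **Positive-part Lennard-Jones sum from the root**: `∑_{z ∈ S} V_LJ(‖z‖)⁺ ≤ 250/12 · δ⁻¹²`
(the root term is `V_LJ(0) = 0`). -/
theorem lintegral_ofReal_lennardJones_le (hδ : 0 < δ) (h0 : (0 : EuclideanSpace ℝ (Fin 3)) ∈ S)
    (hsep : ∀ x ∈ S, ∀ y ∈ S, x ≠ y → δ ≤ dist x y) :
    ∫⁻ z, ENNReal.ofReal (lennardJones ‖z‖)
      ∂((Measure.count : Measure (EuclideanSpace ℝ (Fin 3))).restrict S)
      ≤ ENNReal.ofReal (250 / 12 * δ⁻¹ ^ 12) := by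
  refine lintegral_count_restrict_le_of_sum_le (countable_of_separated hδ hsep) fun T hT => ?_
  have hpt : ∀ z ∈ T, ENNReal.ofReal (lennardJones ‖z‖) ≤
      ENNReal.ofReal ((1 / 12) * δ⁻¹ ^ 6 * ‖z‖⁻¹ ^ 6) := by
    intro z hz
    by_cases hz0 : z = 0
    · subst hz0
      simp [lennardJones_zero]
    · apply ENNReal.ofReal_le_ofReal
      refine lennardJones_le_of_le hδ ?_
      have := hsep z (hT hz) 0 h0 hz0
      rwa [dist_zero_right] at this
  calc ∑ z ∈ T, ENNReal.ofReal (lennardJones ‖z‖)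
      ≤ ∑ z ∈ T, ENNReal.ofReal ((1 / 12) * δ⁻¹ ^ 6 * ‖z‖⁻¹ ^ 6) := Finset.sum_le_sum hpt
    _ = ENNReal.ofReal (∑ z ∈ T, (1 / 12) * δ⁻¹ ^ 6 * ‖z‖⁻¹ ^ 6) :=
        (ENNReal.ofReal_sum_of_nonneg fun z _ => by positivity).symm
    _ ≤ ENNReal.ofReal (250 / 12 * δ⁻¹ ^ 12) := by
        apply ENNReal.ofReal_le_ofReal
        rw [← Finset.mul_sum]
        have h6 : (0 : ℝ) ≤ δ⁻¹ ^ 6 := by positivity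
        have h12 : (δ⁻¹ ^ 12 : ℝ) = δ⁻¹ ^ 6 * δ⁻¹ ^ 6 := by ring
        rw [h12]
        nlinarith [sum_inv_norm_pow_six_le hδ h0 hsep T hT,
          mul_le_mul_of_nonneg_left (sum_inv_norm_pow_six_le hδ h0 hsep T hT) h6]

/-- The Lennard-Jones potential is measurable. -/
theorem measurable_lennardJones : Measurable lennardJones := by
  unfold lennardJones
  exact ((measurable_inv.pow_const 12).const_mul _).sub ((measurable_inv.pow_const 6).const_mul _)

/-- `y ↦ V_LJ(‖y‖)⁺` is measurable (as `ofReal`). -/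
theorem measurable_ofReal_lennardJones_norm :
    Measurable fun y : EuclideanSpace ℝ (Fin 3) => ENNReal.ofReal (lennardJones ‖y‖) :=
  ENNReal.measurable_ofReal.comp (measurable_lennardJones.comp measurable_norm)

/-- `y ↦ V_LJ(‖y‖)⁻` is measurable (as `ofReal`). -/
theorem measurable_ofReal_neg_lennardJones_norm :
    Measurable fun y : EuclideanSpace ℝ (Fin 3) => ENNReal.ofReal (-lennardJones ‖y‖) :=
  ENNReal.measurable_ofReal.comp (measurable_lennardJones.comp measurable_norm).neg

/-- `y ↦ ‖y‖⁻⁶` is measurable (as `ofReal`). -/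
theorem measurable_ofReal_inv_norm_pow_six :
    Measurable fun y : EuclideanSpace ℝ (Fin 3) => ENNReal.ofReal (‖y‖⁻¹ ^ 6) :=
  ENNReal.measurable_ofReal.comp ((measurable_norm.inv).pow_const 6)

end Sums

/-! ## The root energy through positive and negative parts -/

section RootEnergy

variable {δ : ℝ}

/-- `rootEnergy'` is Giry-measurable. -/
theorem measurable_rootEnergy' : Measurable rootEnergy' :=
  ((ENNReal.measurable_toReal.comp (Measure.measurable_lintegral measurable_ofReal_lennardJones_norm)).sub
    (ENNReal.measurable_toReal.comp
      (Measure.measurable_lintegral measurable_ofReal_neg_lennardJones_norm))).div_const 2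

/-- A real function whose positive and negative parts have finite `lintegral`s is integrable. -/
theorem integrable_of_lintegral_ofReal_ne_top {α : Type*} [MeasurableSpace α] {μ : Measure α}
    {f : α → ℝ} (hf : Measurable f) (hpos : ∫⁻ x, ENNReal.ofReal (f x) ∂μ ≠ ∞)
    (hneg : ∫⁻ x, ENNReal.ofReal (-f x) ∂μ ≠ ∞) : Integrable f μ := by
  refine ⟨hf.aestronglyMeasurable, ?_⟩
  rw [hasFiniteIntegral_iff_enorm]
  have hle : ∀ x, ‖f x‖ₑ ≤ ENNReal.ofReal (f x) + ENNReal.ofReal (-f x) := by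
    intro x
    rw [Real.enorm_eq_ofReal_abs]
    rcases le_total 0 (f x) with h | h
    · rw [abs_of_nonneg h]; exact le_self_add
    · rw [abs_of_nonpos h]; exact le_add_self
  calc ∫⁻ x, ‖f x‖ₑ ∂μ ≤ ∫⁻ x, ENNReal.ofReal (f x) + ENNReal.ofReal (-f x) ∂μ := lintegral_mono hle
    _ = ∫⁻ x, ENNReal.ofReal (f x) ∂μ + ∫⁻ x, ENNReal.ofReal (-f x) ∂μ :=
        lintegral_add_left (ENNReal.measurable_ofReal.comp hf) _
    _ < ∞ := ENNReal.add_lt_top.2 ⟨hpos.lt_top, hneg.lt_top⟩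

/-- On rooted hard-core configurations: the positive LJ `lintegral` is finite. -/
theorem lintegral_pos_ne_top_of_hc (hδ : 0 < δ) {μ : Measure (EuclideanSpace ℝ (Fin 3))}
    (h : IsRootedHardCore δ μ) : ∫⁻ y, ENNReal.ofReal (lennardJones ‖y‖) ∂μ ≠ ∞ := by
  obtain ⟨S, h0, hsep, rfl⟩ := h
  exact ((lintegral_ofReal_lennardJones_le hδ h0 hsep).trans_lt ENNReal.ofReal_lt_top).ne

/-- On rooted hard-core configurations: the negative LJ `lintegral` is at most `250/6 · δ⁻⁶`. -/
theorem lintegral_neg_le_of_hc (hδ : 0 < δ) {μ : Measure (EuclideanSpace ℝ (Fin 3))}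
    (h : IsRootedHardCore δ μ) :
    ∫⁻ y, ENNReal.ofReal (-lennardJones ‖y‖) ∂μ ≤ ENNReal.ofReal (250 / 6 * δ⁻¹ ^ 6) := by
  obtain ⟨S, h0, hsep, rfl⟩ := h
  exact lintegral_ofReal_neg_lennardJones_le hδ h0 hsep

/-- On rooted hard-core configurations: the positive LJ `lintegral` is at most `250/12 · δ⁻¹²`. -/
theorem lintegral_pos_le_of_hc (hδ : 0 < δ) {μ : Measure (EuclideanSpace ℝ (Fin 3))}
    (h : IsRootedHardCore δ μ) :
    ∫⁻ y, ENNReal.ofReal (lennardJones ‖y‖) ∂μ ≤ ENNReal.ofReal (250 / 12 * δ⁻¹ ^ 12) := by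
  obtain ⟨S, h0, hsep, rfl⟩ := h
  exact lintegral_ofReal_lennardJones_le hδ h0 hsep

/-- On rooted hard-core configurations: `∑ ‖z‖⁻⁶ ≤ 250 δ⁻⁶`. -/
theorem lintegral_inv_six_le_of_hc (hδ : 0 < δ)
    {μ : Measure (EuclideanSpace ℝ (Fin 3))} (h : IsRootedHardCore δ μ) :
    ∫⁻ y, ENNReal.ofReal (‖y‖⁻¹ ^ 6) ∂μ ≤ ENNReal.ofReal (250 * δ⁻¹ ^ 6) := by
  obtain ⟨S, h0, hsep, rfl⟩ := h
  exact lintegral_inv_norm_pow_six_le hδ h0 hsep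

/-- **`rootEnergy'` is the Bochner root energy on hard-core configurations.** -/
theorem rootEnergy'_eq_of_hc (hδ : 0 < δ) {μ : Measure (EuclideanSpace ℝ (Fin 3))}
    (h : IsRootedHardCore δ μ) : rootEnergy' μ = (∫ y, lennardJones ‖y‖ ∂μ) / 2 := by
  have hint : Integrable (fun y : EuclideanSpace ℝ (Fin 3) => lennardJones ‖y‖) μ :=
    integrable_of_lintegral_ofReal_ne_top (measurable_lennardJones.comp measurable_norm)
      (lintegral_pos_ne_top_of_hc hδ h)
      (((lintegral_neg_le_of_hc hδ h).trans_lt ENNReal.ofReal_lt_top).ne)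
  rw [rootEnergy', integral_eq_lintegral_pos_part_sub_lintegral_neg_part hint]

/-- Bounds on `rootEnergy'` over rooted hard-core configurations. -/
theorem rootEnergy'_bounds_of_hc (hδ : 0 < δ) {μ : Measure (EuclideanSpace ℝ (Fin 3))}
    (h : IsRootedHardCore δ μ) :
    -(250 / 12 * δ⁻¹ ^ 6) ≤ rootEnergy' μ ∧ rootEnergy' μ ≤ 250 / 24 * δ⁻¹ ^ 12 := by
  have hp : (∫⁻ y, ENNReal.ofReal (lennardJones ‖y‖) ∂μ).toReal ≤ 250 / 12 * δ⁻¹ ^ 12 :=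
    ENNReal.toReal_le_of_le_ofReal (by positivity) (lintegral_pos_le_of_hc hδ h)
  have hn : (∫⁻ y, ENNReal.ofReal (-lennardJones ‖y‖) ∂μ).toReal ≤ 250 / 6 * δ⁻¹ ^ 6 :=
    ENNReal.toReal_le_of_le_ofReal (by positivity) (lintegral_neg_le_of_hc hδ h)
  have hp0 : 0 ≤ (∫⁻ y, ENNReal.ofReal (lennardJones ‖y‖) ∂μ).toReal := ENNReal.toReal_nonneg
  have hn0 : 0 ≤ (∫⁻ y, ENNReal.ofReal (-lennardJones ‖y‖) ∂μ).toReal := ENNReal.toReal_nonneg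
  unfold rootEnergy'
  constructor <;> linarith

end RootEnergy

end Summit.AtomisticToContinuum.Crystallization.Theorems.PalmUnimodularRigidityMinimiserShells.EnergyFloor

end
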